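import Literature.NumberTheory.ComplexMultiplication.CMAlgebraTorusReducedModule
import Literature.NumberTheory.ComplexMultiplication.CMAlgebraTorusRosatiStableSubalgebra
import Literature.AlgebraicGeometry.Motives.HodgeStructureCMIsotypicEndomorphismCenter
import Literature.RingTheory.SimpleModule.WedderburnArtinUniquenessSemisimple
import Literature.Geometry.Kaehler.ComplexTorusSimpleEndomorphismAlgebra
import HarnessLib

/-!
# `End_ℚ(X) ≅ ∏ᵢ M_{dᵢ}(Kᵢ)` over CM FIELDS `Kᵢ`, with `H₁(X, ℚ) ≅ ⊕ᵢ Kᵢ^{dᵢ}`, for a complex abelian variety with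
# complex multiplication `[End_ℚ(X) : ℚ]_red = 2 dim X`; a SIMPLE one has `End_ℚ(X)` a CM field of degree `2 dim X`
# (Milne, *Complex Multiplication*, Ch. I §3 Prop. 3.1, Remark 3.5, Prop. 3.6 (a), (c) — torus level)

[topic NumberTheory/ComplexMultiplication]

Family `hodge`, lane `lit-hodgefound` (Track 2 foundations library; skeleton seat `lit-hodgefound-skel-3`, generation 65,
row **A3-G156** «the blocks of `End⁰(A)` are matrix algebras over CM fields»), layer
`Literature/NumberTheory/ComplexMultiplication`, namespace `Literature.NumberTheory.ComplexMultiplication`.  THEOREMS ONLY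
(no definition, no instance, no notation, no named fact; net debt `0`, D-0026).  The file is the TORUS-LEVEL twin of
A3-G155 (`AlgebraicGeometry/Motives/HodgeStructureCMEndomorphismAlgebraMatrixCMFields`, the same statements for p02's
polarizable `ℚ`-Hodge structures), on the carrier of the tree's Layer A3: `X = E/P(ℤ^ι)` a complex torus with period
isomorphism `P : ℝ^ι ≃ E`, `H₁(X, ℚ) = ℚ^ι` (`#ι = 2 dim X`), `End_ℚ(X) = endAlgRat P ⊆ M_ι(ℚ)` acting on `ℚ^ι` by
`Matrix.mulVec`, «abelian variety» = `IsAbelianVariety P` (a Riemann form `η` exists, `IsRiemannForm P η`), «complex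
multiplication» = MILNE'S DEF. 3.2 `[End_ℚ(X) : ℚ]_red = #ι` (A3-G141 `reducedDegree`), «simple» = `IsSimple P`.
It is the `HodgeTensorFacts`-free and structure-free companion of p19's `MumfordTateTorusAbelianVarietyStructure`
(the same algebra shape from «`MT(X)(ℂ)` is a torus» through a chosen CM-structure `IsCMAlgTorusRat P ρ` and the
simple CM factors), now for EVERY Wedderburn decomposition of `End_ℚ(X)`.

## The print

J. S. Milne, *Complex Multiplication* (course notes, version of 2020) [MilneCM2006], Ch. I §3 pp. 27–28 (open text
`paper:url-8ccc30e4daab`, re-read for this row: p0027 L29–L35, p0028 L11–L27), VERBATIM: «PROPOSITION 3.1 For any abelian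
variety `A`, `2 dim A ≥ [End⁰(A) : ℚ]_red`. When equality holds, `End⁰(A)` is a product of matrix algebras over fields.
[…] DEFINITION 3.2 A complex abelian variety `A` is said to have complex multiplication […] if `2 dim A = [End⁰(A):ℚ]_red`.
[…] REMARK 3.5 Let `A ∼ ∏ᵢ Aᵢ^{nᵢ}` be the decomposition of `A` (up to isogeny) into a product of isotypic abelian
varieties. Then `Dᵢ = End⁰(Aᵢ)` is a division algebra, and `End⁰(A) ≃ ∏ᵢ M_{nᵢ}(Dᵢ)` is the decomposition [of]
`End⁰(A)` into a product of simple `ℚ`-algebras. From (3.3), we see that `A` has complex multiplication if and only if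
`Dᵢ` is a commutative field of degree `2 dim Aᵢ` for all `i`. In particular, a simple abelian variety `A` has complex
multiplication if and only if `End⁰(A)` is a field of degree `2 dim A` over `ℚ` […]. PROPOSITION 3.6 (a) A simple
abelian variety `A` has complex multiplication if and only if `End⁰(A)` is a CM-field of degree `2 dim A` over `ℚ`.
[…] (c) An abelian variety `A` has complex multiplication if and only if `End⁰(A)` contains an étale `ℚ`-algebra (which
can be chosen to be a CM-algebra invariant under some Rosati involution) of degree `2 dim A` over `ℚ` (in which case
`H₁(A, ℚ)` is free of rank `1` over the algebra).»; p. 29 «Let `E₀` be the centre of `End⁰(A)`. There exists a CM-type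
`Φ₀` on `E₀` […]».

## The mechanism (no Mumford–Tate group, no tensor-construction facts, no chosen CM-structure)

For `End_ℚ(X)` semisimple (every abelian variety: Poincaré, `IsAbelianVariety.isSemisimpleRing_endAlgRat`) acting
faithfully on `ℚ^ι`, `[End_ℚ(X):ℚ]_red = #ι` is the equality case of Prop. 1.2, so `End_ℚ(X) ≃ ∏ᵢ M_{dᵢ}(Kᵢ)` over
NUMBER FIELDS (A3-G141 FILE 4 `exists_algEquiv_endAlgRat_pi_matrix_field_of_reducedDegree_eq`; §1 normalises the
`ℚ`-algebra structures to the canonical ones).  The centre `Z(End_ℚ X) ≃ ∏ᵢ Z(Kᵢ) = ∏ᵢ M₁(Kᵢ)` block-scalarly (p26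
`EndAction.nonempty_center_algEquiv_pi_center`), while under CM the centre IS the commutant `C(End_ℚ X) ⊆ M_ι(ℚ)`
(Prop. 3.3 (c) «and equals `C(A)`», A3-G140 `Matrix.centralizer_eq_inf_of_exists_comm_isReduced`), which for a
POLARISED `X` is `ρ(∏ⱼ K′ⱼ)` with CM FIELDS `K′ⱼ` (A3-G149 FILE 2 `exists_isCMField_range_eq_centralizer_endAlgRat`:
Deligne's «`h(i) ∈ E ⊗ ℝ`, `h(i)* = -h(i)`» below every idempotent, Cor. 1.40).  Wedderburn–Artin uniqueness for
`∏ᵢ M₁(Kᵢ) ≃ Z ≃ ∏ⱼ M₁(K′ⱼ)` (the tree's `exists_equiv_forall_eq_and_nonempty_algEquiv_of_algEquiv_pi_matrix`, Lam (3.5))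
matches every `Kᵢ` with some `K′ⱼ`: EVERY `Kᵢ` IS A CM FIELD (§2), in EVERY decomposition; a second application
transfers this to decompositions over division algebras `Dⱼ` («`Dᵢ` is a commutative field», §2).  `ℚ^ι` is the reduced
module `⊕ᵢ Kᵢ^{dᵢ}` by A3-G146 FILE 4 (§3).  For `X` SIMPLE, `End_ℚ(X)` is a division algebra (Lange Cor. 2.4.26,
`IsSimple.isUnit_endAlgRat`), and a division algebra `≃ ∏ᵢ M_{dᵢ}(Kᵢ)` has exactly one block, of size `1` (a matrix unit
`e₀₁` is a non-zero element of square zero; two structure idempotents multiply to zero): `End_ℚ(X) ≅ K` is a field of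
degree `[K:ℚ] = [End_ℚ X : ℚ]_red = #ι`, CM by §2 (§4).

## What is proved (`P : (ι → ℝ) ≃L[ℝ] E`, `X = E/P(ℤ^ι)`, `#ι = 2 dim X`)

§1 **PROP. 3.1, SECOND SENTENCE, with number-field instances**: `exists_algEquiv_endAlgRat_pi_matrix_numberField_of_reducedDegree_eq`
(`End_ℚ(X)` semisimple, `[End_ℚ X:ℚ]_red = #ι` ⟹ `End_ℚ(X) ≃ₐ[ℚ] ∏ᵢ M_{dᵢ}(Kᵢ)`, `Kᵢ` number fields with their
canonical `ℚ`-algebra structure, `dᵢ ≥ 1`), `IsAbelianVariety.exists_algEquiv_endAlgRat_pi_matrix_numberField`, and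
**`card_eq_sum_of_algEquiv_endAlgRat_pi_matrix`** (`2 dim X = #ι = Σᵢ dᵢ[Kᵢ:ℚ]` along any such decomposition — Remark
3.5's degrees summed), `reducedDegree_endAlgRat_eq_card_of_algEquiv_pi_matrix` (conversely a decomposition over fields
with `Σᵢ dᵢ[Kᵢ:ℚ] = #ι` gives CM — «if and only if `Dᵢ` is a commutative field of degree …»).

§2 ★★ **THE BLOCKS ARE OVER CM FIELDS, IN EVERY DECOMPOSITION**: `isCMField_of_algEquiv_endAlgRat_pi_matrix` (a
`(1,1)`-form `η` with `η(iu,u) > 0` and rational Gram matrix; `[End_ℚ X:ℚ]_red = #ι`; ANY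
`e : End_ℚ(X) ≃ₐ[ℚ] ∏ᵢ M_{dᵢ}(Kᵢ)` over number fields ⟹ every `Kᵢ` is a CM field), the polarised forms
★★ **`IsRiemannForm.isCMField_of_algEquiv_endAlgRat_pi_matrix`**, ★★ **`IsAbelianVariety.isCMField_of_algEquiv_endAlgRat_pi_matrix`**,
and REMARK 3.5 read on division algebras: ★ **`IsAbelianVariety.exists_isCMField_of_algEquiv_endAlgRat_pi_matrix_divisionRing`**
(for ANY `e′ : End_ℚ(X) ≃ₐ[ℚ] ∏ⱼ M_{d′ⱼ}(Dⱼ)` over division `ℚ`-algebras, every `Dⱼ` is `≃ₐ[ℚ]` a CM number field),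
`IsAbelianVariety.divisionRing_mul_comm_of_algEquiv_endAlgRat_pi_matrix` («`Dᵢ` is a commutative field»),
`IsAbelianVariety.card_eq_sum_of_algEquiv_endAlgRat_pi_matrix_divisionRing` (`#ι = Σⱼ d′ⱼ[Dⱼ:ℚ]`).

§3 ★★ **THE PACKAGE** `IsAbelianVariety.exists_algEquiv_endAlgRat_pi_matrix_isCMField` (`End_ℚ(X) ≃ ∏ᵢ M_{dᵢ}(Kᵢ)` over
CM fields with `#ι = Σ dᵢ[Kᵢ:ℚ]`), ★★ `IsAbelianVariety.exists_algEquiv_endAlgRat_pi_matrix_isCMField_linearEquiv` (the same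
WITH `f : ℚ^ι ≃ₗ[ℚ] ⊕ᵢ Kᵢ^{dᵢ}`, `f (M *ᵥ v) = e M • f v` — «`H₁(A, ℚ)` is free of rank `1` over the algebra», A3-G146
FILE 4 by name), and the algebra-level form of REMARK 3.5's «if and only if»:
★ **`IsAbelianVariety.reducedDegree_endAlgRat_eq_card_iff_exists_algEquiv_pi_matrix_isCMField`**.

§4 **SIMPLE TORI (Remark 3.5 «In particular», Prop. 3.6 (a))**: for `X` simple (`#ι ≥ 1`) with `[End_ℚ X:ℚ]_red = #ι`:
`IsSimple.endAlgRat_mul_comm_of_reducedDegree_eq`, `IsSimple.isField_endAlgRat_of_reducedDegree_eq`,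
`IsSimple.finrank_endAlgRat_eq_card_of_reducedDegree_eq` (`End_ℚ(X)` is a FIELD of degree `#ι` — no polarisation needed),
the converse `reducedDegree_endAlgRat_eq_card_of_isField_of_finrank_eq` (any torus), ★
**`IsSimple.reducedDegree_endAlgRat_eq_card_iff_isField`** («a simple abelian variety `A` has complex multiplication if and
only if `End⁰(A)` is a field of degree `2 dim A`» — for every simple complex torus), and for a simple ABELIAN VARIETY ★★
**`IsSimple.exists_isCMField_algEquiv_endAlgRat_of_reducedDegree_eq`** (`End_ℚ(X) ≃ₐ[ℚ] K`, `K` a CM FIELD, `[K:ℚ] = #ι`)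
and ★★ **`IsSimple.reducedDegree_endAlgRat_eq_card_iff_exists_isCMField`** (PROP. 3.6 (a) as an «if and only if»).  (p19's
`IsAbelianVariety.exists_isCMField_algEquiv_endAlgRat_of_isSimple_of_isTorusSubgroup_mumfordTateGroupC` is the same
conclusion from «`MT(X)(ℂ)` is a torus», through a CM-structure.)

NOT here: the geometric isotypic decomposition `A ∼ ∏ᵢ Aᵢ^{nᵢ}` itself and «`2 dim Aᵢ = [Dᵢ:ℚ]`» factor by factor
(p19's `IsAbelianVariety.exists_simple_cm_factors_of_isTorusSubgroup_mumfordTateGroupC`, under `[HodgeTensorFacts]`), Prop.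
3.6 (b), and the Rosati clause of (c) (A3-G137 FILE 4 / A3-G149 FILE 2).

## References

* [MilneCM2006] J. S. Milne, *Complex Multiplication* (2006/2020), Ch. I §1 Prop. 1.2 (p. 9); §3 Prop. 3.1, Def. 3.2,
  Prop. 3.3, Remark 3.5, Prop. 3.6 (pp. 27–28); p. 29 (the centre `E₀` is a CM-algebra).
* [Deligne1982HodgeCycles] P. Deligne, *Hodge cycles on abelian varieties*, LNM 900 (1982), I §5 Prop. 5.1 (p. 53).
* [Lange2023AbelianVarietiesComplex] H. Lange, *Abelian Varieties over the Complex Numbers* (2023), §2.4.4 Cor. 2.4.26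
  (`End_ℚ(X) ≅ ⊕ M_{nᵢ}(Fᵢ)`; a simple torus has a skew field), §7.2.3 Prop. 7.2.6.
* [Shimura1998] G. Shimura, *Abelian Varieties with Complex Multiplication and Modular Functions* (1998), §5.1 Props. 3–6.
* [Lam2001FirstCourse] T. Y. Lam, *A First Course in Noncommutative Rings* (2001), §3 (3.5) (Wedderburn–Artin uniqueness).

## Provenance

Lane `lit-hodgefound`, seat `literature-prover-lit-hodgefound-skel-3-g65-0` (row A3-G156).
-/

noncomputable section

open Module Matrix NumberField

namespace Literature.NumberTheory.ComplexMultiplication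

open Literature.RingTheory.CentralSimple Literature.RingTheory.SimpleModule
open Literature.Geometry.Kaehler
open Literature.Geometry.Kaehler.ComplexTorus
open Literature.AlgebraicGeometry.Motives.HodgeStructure.EndAction (nonempty_center_algEquiv_pi_center)

/-! ## §0 Plumbing -/

section Plumbing

/-- A number field isomorphic to a CM field is a CM field (Mathlib's `IsCMField`: totally complex and quadratic over its
maximal real subfield; both transported along `e`). [folklore] -/
private theorem isCMField_of_ringEquiv₆₅ {K K' : Type*} [Field K] [NumberField K] [IsCMField K] [Field K'] [NumberField K']
    (e : K ≃+* K') : IsCMField K' := by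
  haveI : IsTotallyComplex K' := by
    letI : Algebra K K' := e.toRingHom.toAlgebra
    exact isTotallyComplex_of_algebra K K'
  letI alg : Algebra (maximalRealSubfield K) K' := (e.toRingHom.comp (maximalRealSubfield K).subtype).toAlgebra
  let eL : K ≃ₗ[maximalRealSubfield K] K' :=
    { e with
      map_smul' := fun c x => by
        change e (c • x) = algebraMap (maximalRealSubfield K) K' c * e x
        rw [Algebra.smul_def, map_mul]
        rfl }
  haveI : Algebra.IsQuadraticExtension (maximalRealSubfield K) K' :=
    { finrank_eq_two' := by
        have h := eL.finrank_eq
        rw [Algebra.IsQuadraticExtension.finrank_eq_two (maximalRealSubfield K) K] at h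
        exact h.symm }
  exact IsCMField.ofCMExtension (maximalRealSubfield K) K'

/-- `M₁(A) ≃ₐ A` (the `(0,0)` entry; Mathlib's `Matrix.uniqueAlgEquiv` is stated for the `Unique`-derived `Fintype` ∕
`DecidableEq` structures on the index type, not the standard ones of `Fin 1`). [folklore] -/
private theorem nonempty_matrix_fin_one_algEquiv₆₅ (A : Type*) [Semiring A] [Algebra ℚ A] :
    Nonempty (Matrix (Fin 1) (Fin 1) A ≃ₐ[ℚ] A) := by
  refine ⟨AlgEquiv.ofBijective
    { toFun := fun M ↦ M 0 0
      map_one' := Matrix.one_apply_eq 0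
      map_mul' := fun M N ↦ by
        change (M * N) 0 0 = M 0 0 * N 0 0
        rw [Matrix.mul_apply, Fin.sum_univ_one]
      map_zero' := rfl
      map_add' := fun M N ↦ rfl
      commutes' := fun r ↦ by
        change (algebraMap ℚ (Matrix (Fin 1) (Fin 1) A) r) 0 0 = algebraMap ℚ A r
        rw [Matrix.algebraMap_matrix_apply, if_pos rfl] } ⟨fun M N h ↦ ?_, fun a ↦ ⟨Matrix.of fun _ _ ↦ a, rfl⟩⟩⟩
  ext i j
  rw [Subsingleton.elim i 0, Subsingleton.elim j 0]
  exact h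

/-- In a ring all of whose non-zero elements are units, `a * a = 0` forces `a = 0`. [folklore] -/
private theorem eq_zero_of_mul_self_eq_zero₆₅ {R : Type*} [Ring R] (hu : ∀ a : R, a ≠ 0 → IsUnit a) {a : R}
    (h : a * a = 0) : a = 0 := by
  by_contra ha
  exact ha ((hu a ha).mul_right_eq_zero.1 h)

/-- A division-like ring `R ≃ₐ ∏ᵢ M_{dᵢ}(Kᵢ)` has all blocks of size `1`: a matrix unit `e₀₁` in a block of size `≥ 2`
would be a non-zero element of square zero. [folklore] -/
private theorem forall_eq_one_of_algEquiv_pi_matrix₆₅ {R : Type*} [Ring R] [Algebra ℚ R] (hu : ∀ a : R, a ≠ 0 → IsUnit a)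
    {κ : Type*} [DecidableEq κ] {K : κ → Type*} [∀ i, Field (K i)] [∀ i, Algebra ℚ (K i)] {d : κ → ℕ} [∀ i, NeZero (d i)]
    (e : R ≃ₐ[ℚ] Π i, Matrix (Fin (d i)) (Fin (d i)) (K i)) (i : κ) : d i = 1 := by
  classical
  have h1 : 1 ≤ d i := Nat.one_le_iff_ne_zero.2 (NeZero.ne (d i))
  by_contra hne
  have h2 : 2 ≤ d i := by omega
  set p : Fin (d i) := ⟨0, by omega⟩ with hp
  set q : Fin (d i) := ⟨1, by omega⟩ with hq
  have hpq : p ≠ q := by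
    intro h
    have := congrArg Fin.val h
    simp [hp, hq] at this
  set x : Matrix (Fin (d i)) (Fin (d i)) (K i) := Matrix.single p q 1 with hx
  have hx0 : x ≠ 0 := by
    intro h
    have h' := congr_fun (congr_fun h p) q
    rw [hx, Matrix.single_apply_same] at h'
    exact one_ne_zero h'
  have hxx : x * x = 0 := by
    rw [hx]
    exact Matrix.single_mul_single_of_ne (c := (1 : K i)) p q p (Ne.symm hpq) 1
  set a : R := e.symm (Pi.single i x) with ha
  have haa : a * a = 0 := by
    rw [ha, ← map_mul]
    have hs : (Pi.single i x : Π j, Matrix (Fin (d j)) (Fin (d j)) (K j)) * Pi.single i x = 0 := by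
      funext k
      rw [Pi.mul_apply, Pi.zero_apply]
      by_cases hki : k = i
      · subst hki
        rw [Pi.single_eq_same, hxx]
      · rw [Pi.single_eq_of_ne hki, zero_mul]
    rw [hs, map_zero]
  have ha0 : a = 0 := eq_zero_of_mul_self_eq_zero₆₅ hu haa
  apply hx0
  have h3 : (Pi.single i x : Π j, Matrix (Fin (d j)) (Fin (d j)) (K j)) = 0 := by
    have h4 : e a = 0 := by rw [ha0, map_zero]
    rwa [ha, e.apply_symm_apply] at h4
  have h5 := congr_fun h3 i
  rwa [Pi.single_eq_same] at h5

/-- … and a single block: two distinct structure idempotents `εᵢ, εⱼ` would multiply to zero. [folklore] -/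
private theorem subsingleton_of_algEquiv_pi_matrix₆₅ {R : Type*} [Ring R] [Algebra ℚ R] (hu : ∀ a : R, a ≠ 0 → IsUnit a)
    {κ : Type*} [DecidableEq κ] {K : κ → Type*} [∀ i, Field (K i)] [∀ i, Algebra ℚ (K i)] {d : κ → ℕ} [∀ i, NeZero (d i)]
    (e : R ≃ₐ[ℚ] Π i, Matrix (Fin (d i)) (Fin (d i)) (K i)) : Subsingleton κ := by
  classical
  refine ⟨fun i j => ?_⟩
  by_contra hij
  haveI : Nonempty (Fin (d i)) := ⟨⟨0, Nat.pos_of_ne_zero (NeZero.ne (d i))⟩⟩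
  set a : R := e.symm (Pi.single i 1) with ha
  set b : R := e.symm (Pi.single j 1) with hb
  have hab : a * b = 0 := by
    rw [ha, hb, ← map_mul]
    have hs : (Pi.single i 1 : Π k, Matrix (Fin (d k)) (Fin (d k)) (K k)) * Pi.single j 1 = 0 := by
      funext k
      rw [Pi.mul_apply, Pi.zero_apply]
      by_cases hki : k = i
      · subst hki
        rw [Pi.single_eq_of_ne hij, mul_zero]
      · rw [Pi.single_eq_of_ne hki, zero_mul]
    rw [hs, map_zero]
  have ha0 : a ≠ 0 := by
    intro h
    have h' : (Pi.single i 1 : Π k, Matrix (Fin (d k)) (Fin (d k)) (K k)) = 0 := by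
      have h4 : e a = 0 := by rw [h, map_zero]
      rwa [ha, e.apply_symm_apply] at h4
    have h5 := congr_fun h' i
    rw [Pi.single_eq_same, Pi.zero_apply] at h5
    exact one_ne_zero h5
  have hb0 : b ≠ 0 := by
    intro h
    have h' : (Pi.single j 1 : Π k, Matrix (Fin (d k)) (Fin (d k)) (K k)) = 0 := by
      have h4 : e b = 0 := by rw [h, map_zero]
      rwa [hb, e.apply_symm_apply] at h4
    haveI : Nonempty (Fin (d j)) := ⟨⟨0, Nat.pos_of_ne_zero (NeZero.ne (d j))⟩⟩
    have h5 := congr_fun h' j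
    rw [Pi.single_eq_same, Pi.zero_apply] at h5
    exact one_ne_zero h5
  exact hb0 (((hu a ha0).mul_right_eq_zero).1 hab)

/-- The centre of a subalgebra `S ⊆ A`, pushed into `A`, is `S ⊓ C(S)`. [folklore] -/
private theorem map_val_center_eq_inf_centralizer₆₅ {F A : Type*} [CommSemiring F] [Semiring A] [Algebra F A]
    (S : Subalgebra F A) :
    (Subalgebra.center F ↥S).map S.val = S ⊓ Subalgebra.centralizer F (S : Set A) := by
  ext x
  rw [Subalgebra.mem_map, Algebra.mem_inf, Subalgebra.mem_centralizer_iff]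
  constructor
  · rintro ⟨z, hz, rfl⟩
    refine ⟨z.2, fun a ha ↦ ?_⟩
    have h := Subalgebra.mem_center_iff.1 hz ⟨a, ha⟩
    exact congrArg Subtype.val h
  · rintro ⟨hxS, hxC⟩
    refine ⟨⟨x, hxS⟩, ?_, rfl⟩
    rw [Subalgebra.mem_center_iff]
    intro b
    exact Subtype.ext (hxC b b.2)

end Plumbing

variable {ι : Type} [Fintype ι] [DecidableEq ι] {E : Type} [NormedAddCommGroup E] [NormedSpace ℂ E]
  (P : (ι → ℝ) ≃L[ℝ] E)

/-! ## §1 Prop. 3.1, second sentence, with number-field instances; `2 dim X = Σᵢ dᵢ[Kᵢ:ℚ]` -/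

section Wedderburn

/-- **MILNE CM PROP. 3.1, SECOND SENTENCE, at torus level with NUMBER-FIELD instances**: for `End_ℚ(X)` semisimple with
`[End_ℚ(X) : ℚ]_red = #ι = 2 dim X`, `End_ℚ(X) ≃ₐ[ℚ] ∏ᵢ M_{dᵢ}(Kᵢ)` with `Kᵢ` NUMBER FIELDS (canonical `ℚ`-algebra
structure) and `dᵢ ≥ 1` — A3-G141 FILE 4's `exists_algEquiv_endAlgRat_pi_matrix_field_of_reducedDegree_eq` with the
(unique) `ℚ`-algebra structures of the fields replaced by the canonical ones («When equality holds, `End⁰(A)` is a product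
of matrix algebras over fields»). [cite: MilneCM2006, Ch. I §3 Prop. 3.1 (p. 27) and §1 Prop. 1.2 (p. 9)] -/
theorem exists_algEquiv_endAlgRat_pi_matrix_numberField_of_reducedDegree_eq [IsSemisimpleRing ↥(endAlgRat P)]
    (h : reducedDegree ℚ ↥(endAlgRat P) = Fintype.card ι) :
    ∃ (m : ℕ) (K : Fin m → Type) (_ : ∀ i, Field (K i)) (_ : ∀ i, NumberField (K i)) (d : Fin m → ℕ),
      (∀ i, NeZero (d i)) ∧ Nonempty (↥(endAlgRat P) ≃ₐ[ℚ] Π i, Matrix (Fin (d i)) (Fin (d i)) (K i)) := by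
  obtain ⟨m, K, instF, instA, d, hd, hfin, ⟨e⟩⟩ := exists_algEquiv_endAlgRat_pi_matrix_field_of_reducedDegree_eq P h
  have hcz : ∀ i, CharZero (K i) := fun i ↦
    charZero_of_injective_algebraMap (algebraMap ℚ (K i)).injective
  -- replace the `ℚ`-algebra structures by the canonical ones (they are all equal)
  have hA : instA = fun i ↦ @DivisionRing.toRatAlgebra (K i) _ (hcz i) := Subsingleton.elim _ _
  subst hA
  exact ⟨m, K, instF, fun i ↦ @NumberField.mk (K i) _ (hcz i) (hfin i), d, hd, ⟨e⟩⟩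

variable {P} in
/-- **For an ABELIAN VARIETY with `[End_ℚ(X) : ℚ]_red = 2 dim X`: `End_ℚ(X) ≃ₐ[ℚ] ∏ᵢ M_{dᵢ}(Kᵢ)` over NUMBER FIELDS**
(Poincaré supplies the semisimplicity). [cite: MilneCM2006, Ch. I §3 Prop. 3.1 (p. 27)] -/
theorem _root_.Literature.Geometry.Kaehler.ComplexTorus.IsAbelianVariety.exists_algEquiv_endAlgRat_pi_matrix_numberField
    (hX : IsAbelianVariety P) (h : reducedDegree ℚ ↥(endAlgRat P) = Fintype.card ι) :
    ∃ (m : ℕ) (K : Fin m → Type) (_ : ∀ i, Field (K i)) (_ : ∀ i, NumberField (K i)) (d : Fin m → ℕ),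
      (∀ i, NeZero (d i)) ∧ Nonempty (↥(endAlgRat P) ≃ₐ[ℚ] Π i, Matrix (Fin (d i)) (Fin (d i)) (K i)) := by
  haveI := hX.isSemisimpleRing_endAlgRat
  exact exists_algEquiv_endAlgRat_pi_matrix_numberField_of_reducedDegree_eq P h

variable {κ : Type*} [Fintype κ] {K : κ → Type*} [∀ i, Field (K i)] [∀ i, Algebra ℚ (K i)]
  [∀ i, FiniteDimensional ℚ (K i)] {d : κ → ℕ} [∀ i, NeZero (d i)]

/-- **`2 dim X = #ι = Σᵢ dᵢ [Kᵢ : ℚ]`** along any `End_ℚ(X) ≃ₐ[ℚ] ∏ᵢ M_{dᵢ}(Kᵢ)` over number fields, when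
`[End_ℚ(X) : ℚ]_red = #ι` (Milne's formula (1.2) `[∏ M_{dᵢ}(Kᵢ) : ℚ]_red = Σ dᵢ[Kᵢ:ℚ]`; Remark 3.5's «`Dᵢ` … of degree
`2 dim Aᵢ`» summed with multiplicities: `2 dim A = Σᵢ nᵢ · 2 dim Aᵢ`). [cite: MilneCM2006, Ch. I §1 (1.2), Prop. 1.2 (p. 9); §3 Remark 3.5 (p. 28)] -/
theorem card_eq_sum_of_algEquiv_endAlgRat_pi_matrix (h : reducedDegree ℚ ↥(endAlgRat P) = Fintype.card ι)
    (e : ↥(endAlgRat P) ≃ₐ[ℚ] Π i, Matrix (Fin (d i)) (Fin (d i)) (K i)) :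
    Fintype.card ι = ∑ i, d i * finrank ℚ (K i) := by
  rw [← h, reducedDegree_eq_of_algEquiv e, ← finrank_pi_vec_eq_reducedDegree d, finrank_pi_vec_eq_sum d]

/-- Conversely, **a decomposition `End_ℚ(X) ≃ₐ[ℚ] ∏ᵢ M_{dᵢ}(Kᵢ)` over (commutative) fields with `Σᵢ dᵢ[Kᵢ:ℚ] = #ι` gives
`[End_ℚ(X) : ℚ]_red = #ι = 2 dim X`** — Remark 3.5's «if and only if `Dᵢ` is a commutative field of degree `2 dim Aᵢ` for
all `i`», read on the algebra (any complex torus). [cite: MilneCM2006, Ch. I §3 Remark 3.5 (p. 28); §1 (1.2) (p. 9)] -/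
theorem reducedDegree_endAlgRat_eq_card_of_algEquiv_pi_matrix
    (e : ↥(endAlgRat P) ≃ₐ[ℚ] Π i, Matrix (Fin (d i)) (Fin (d i)) (K i))
    (hcard : Fintype.card ι = ∑ i, d i * finrank ℚ (K i)) :
    reducedDegree ℚ ↥(endAlgRat P) = Fintype.card ι := by
  rw [hcard, reducedDegree_eq_of_algEquiv e, ← finrank_pi_vec_eq_reducedDegree d, finrank_pi_vec_eq_sum d]

end Wedderburn

/-! ## §2 The blocks are over CM fields, in every decomposition -/

section CMBlocks

variable {P} {η : E [⋀^Fin 2]→L[ℝ] ℝ}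
  (h₁₁ : ∀ u v : E, η ![Complex.I • u, Complex.I • v] = η ![u, v])
  (hpos : ∀ u : E, u ≠ 0 → 0 < η ![Complex.I • u, u])
  {G : Matrix ι ι ℚ} (hG : G.map (Rat.cast : ℚ → ℝ) = latticeGram P η)
  {κ : Type*} [Fintype κ] {K : κ → Type*} [∀ i, Field (K i)] [∀ i, NumberField (K i)] {d : κ → ℕ}
  [∀ i, NeZero (d i)]

include h₁₁ hpos hG in
/-- ★★ **THE BLOCKS OF `End_ℚ(X) ≅ ∏ᵢ M_{dᵢ}(Kᵢ)` ARE OVER CM FIELDS** — for a complex torus `X = E/P(ℤ^ι)` carrying a real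
`(1,1)`-form `η` with `η(iu, u) > 0` and rational Gram matrix `G` (every polarisation), with complex multiplication
`[End_ℚ(X) : ℚ]_red = #ι = 2 dim X`: for EVERY `e : End_ℚ(X) ≃ₐ[ℚ] ∏ᵢ M_{dᵢ}(Kᵢ)` over number fields (`dᵢ ≥ 1`), every
`Kᵢ` is a CM field («`End⁰(A) ≃ ∏ᵢ M_{nᵢ}(Dᵢ)` … `Dᵢ` is a commutative field» with Prop. 3.6 (a) «CM-field»; «Let `E₀` be
the centre of `End⁰(A)`. There exists a CM-type `Φ₀` on `E₀`»).  Road: `Z(End_ℚ X) ≃ ∏ᵢ M₁(Kᵢ)` block-scalarly;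
`Z(End_ℚ X) = C(End_ℚ X) = ρ(∏ⱼ K′ⱼ)` with `K′ⱼ` CM (A3-G149 FILE 2); Wedderburn–Artin uniqueness matches each `Kᵢ` with
some `K′ⱼ`. [cite: MilneCM2006, Ch. I §3 Remark 3.5, Prop. 3.6 (a) (p. 28) and p. 29 («the centre of `End⁰(A)`»)]
[cite: Deligne1982HodgeCycles, I §5 Prop. 5.1 (p. 53)] [cite: Lam2001FirstCourse, §3 (3.5)] -/
theorem isCMField_of_algEquiv_endAlgRat_pi_matrix (h : reducedDegree ℚ ↥(endAlgRat P) = Fintype.card ι)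
    (e : ↥(endAlgRat P) ≃ₐ[ℚ] Π i, Matrix (Fin (d i)) (Fin (d i)) (K i)) (i : κ) : IsCMField (K i) := by
  classical
  haveI : ∀ j, Nonempty (Fin (d j)) := fun j ↦ ⟨⟨0, Nat.pos_of_ne_zero (NeZero.ne (d j))⟩⟩
  -- (a) ⟹ (b): an étale `T ⊆ End_ℚ(X)` of dimension `2 dim X`
  have hex := (reducedDegree_endAlgRat_eq_card_iff_exists_comm_isReduced P).1 h
  -- `e₁ : Z(End_ℚ X) ≃ ∏ᵢ M₁(Kᵢ)` (block scalars)
  obtain ⟨θ⟩ := nonempty_center_algEquiv_pi_center e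
  let κ₁ : ∀ j, ↥(Subalgebra.center ℚ (K j)) ≃ₐ[ℚ] Matrix (Fin 1) (Fin 1) (K j) := fun j ↦
    ((Subalgebra.equivOfEq _ _ (Subalgebra.center_eq_top ℚ (K j))).trans Subalgebra.topEquiv).trans
      (Classical.choice (nonempty_matrix_fin_one_algEquiv₆₅ (K j))).symm
  let e₁ : ↥(Subalgebra.center ℚ ↥(endAlgRat P)) ≃ₐ[ℚ] Π j, Matrix (Fin 1) (Fin 1) (K j) :=
    θ.trans (AlgEquiv.piCongrRight κ₁)
  -- `e₂ : Z(End_ℚ X) = C(End_ℚ X) = ρ(∏ⱼ K′ⱼ) ≃ ∏ⱼ M₁(K′ⱼ)` with `K′ⱼ` CM fields (A3-G149 FILE 2, A3-G140)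
  obtain ⟨t, ft, K', fK', nK', cmK', ρ, hρinj, hρrange, -, -⟩ :=
    exists_isCMField_range_eq_centralizer_endAlgRat h₁₁ hpos hG hex
  have hmap : (Subalgebra.center ℚ ↥(endAlgRat P)).map (endAlgRat P).val =
      Subalgebra.centralizer ℚ (endAlgRat P : Set (Matrix ι ι ℚ)) := by
    rw [map_val_center_eq_inf_centralizer₆₅, ← Matrix.centralizer_eq_inf_of_exists_comm_isReduced hex]
  let e₂ : ↥(Subalgebra.center ℚ ↥(endAlgRat P)) ≃ₐ[ℚ] Π j, Matrix (Fin 1) (Fin 1) (K' j) :=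
    ((((Subalgebra.center ℚ ↥(endAlgRat P)).equivMapOfInjective (endAlgRat P).val Subtype.val_injective).trans
      (Subalgebra.equivOfEq _ _ (hmap.trans hρrange.symm))).trans (AlgEquiv.ofInjective ρ hρinj).symm).trans
      (AlgEquiv.piCongrRight fun j ↦ (Classical.choice (nonempty_matrix_fin_one_algEquiv₆₅ (K' j))).symm)
  -- Wedderburn–Artin uniqueness: `Kᵢ ≃ₐ[ℚ] K′_{σ i}`
  obtain ⟨σ, hσ⟩ := exists_equiv_forall_eq_and_nonempty_algEquiv_of_algEquiv_pi_matrix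
    (R := ↥(Subalgebra.center ℚ ↥(endAlgRat P))) (d := fun _ ↦ 1) (d' := fun _ ↦ 1) e₁ e₂
  obtain ⟨φ⟩ := (hσ i).2
  exact isCMField_of_ringEquiv₆₅ φ.symm.toRingEquiv

/-- ★★ **POLARISED FORM: for an abelian variety `(X, η)` (`IsRiemannForm P η`) with `[End_ℚ(X) : ℚ]_red = 2 dim X`, EVERY
decomposition `End_ℚ(X) ≃ₐ[ℚ] ∏ᵢ M_{dᵢ}(Kᵢ)` over number fields has CM FIELDS `Kᵢ`** (Remark 3.5 with Prop. 3.6 (a)).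
[cite: MilneCM2006, Ch. I §3 Remark 3.5, Prop. 3.6 (a) (p. 28)] [cite: Deligne1982HodgeCycles, I §5 Prop. 5.1 (p. 53)] -/
theorem _root_.Literature.Geometry.Kaehler.ComplexTorus.IsRiemannForm.isCMField_of_algEquiv_endAlgRat_pi_matrix
    (hη : IsRiemannForm P η) (h : reducedDegree ℚ ↥(endAlgRat P) = Fintype.card ι)
    (e : ↥(endAlgRat P) ≃ₐ[ℚ] Π i, Matrix (Fin (d i)) (Fin (d i)) (K i)) (i : κ) : IsCMField (K i) := by
  obtain ⟨G, hG⟩ := hη.exists_ratMatrix_latticeGram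
  exact Literature.NumberTheory.ComplexMultiplication.isCMField_of_algEquiv_endAlgRat_pi_matrix hη.1 hη.2.2 hG h e i

/-- ★★ **For an ABELIAN VARIETY `X` (some polarisation exists) with `[End_ℚ(X) : ℚ]_red = 2 dim X`, EVERY decomposition
`End_ℚ(X) ≃ₐ[ℚ] ∏ᵢ M_{dᵢ}(Kᵢ)` over number fields has CM FIELDS `Kᵢ`.** [cite: MilneCM2006, Ch. I §3 Remark 3.5, Prop. 3.6 (a) (p. 28)]
[cite: Deligne1982HodgeCycles, I §5 Prop. 5.1 (p. 53)] -/
theorem _root_.Literature.Geometry.Kaehler.ComplexTorus.IsAbelianVariety.isCMField_of_algEquiv_endAlgRat_pi_matrix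
    (hX : IsAbelianVariety P) (h : reducedDegree ℚ ↥(endAlgRat P) = Fintype.card ι)
    (e : ↥(endAlgRat P) ≃ₐ[ℚ] Π i, Matrix (Fin (d i)) (Fin (d i)) (K i)) (i : κ) : IsCMField (K i) := by
  obtain ⟨η, hη⟩ := hX
  exact hη.isCMField_of_algEquiv_endAlgRat_pi_matrix h e i

variable {κ' : Type*} [Fintype κ'] {D : κ' → Type*} [∀ j, DivisionRing (D j)] [∀ j, Algebra ℚ (D j)] {d' : κ' → ℕ}
  [∀ j, NeZero (d' j)]

/-- ★ **REMARK 3.5 READ ON DIVISION ALGEBRAS: for an abelian variety with `[End_ℚ(X) : ℚ]_red = 2 dim X` and ANY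
decomposition `e′ : End_ℚ(X) ≃ₐ[ℚ] ∏ⱼ M_{d′ⱼ}(Dⱼ)` into matrix algebras over DIVISION `ℚ`-algebras (e.g. the Wedderburn
decomposition «`End⁰(A) ≃ ∏ᵢ M_{nᵢ}(Dᵢ)`, `Dᵢ = End⁰(Aᵢ)`»), every `Dⱼ` is (isomorphic to) a CM NUMBER FIELD** — «`A` has
complex multiplication if and only if `Dᵢ` is a commutative field …», (a) «CM-field»: Wedderburn–Artin uniqueness against
§1's decomposition over fields, whose blocks are CM by the previous theorem.
[cite: MilneCM2006, Ch. I §3 Remark 3.5, Prop. 3.6 (a) (p. 28)] [cite: Lam2001FirstCourse, §3 (3.5)] -/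
theorem _root_.Literature.Geometry.Kaehler.ComplexTorus.IsAbelianVariety.exists_isCMField_of_algEquiv_endAlgRat_pi_matrix_divisionRing
    (hX : IsAbelianVariety P) (h : reducedDegree ℚ ↥(endAlgRat P) = Fintype.card ι)
    (e' : ↥(endAlgRat P) ≃ₐ[ℚ] Π j, Matrix (Fin (d' j)) (Fin (d' j)) (D j)) (j : κ') :
    ∃ (K : Type) (_ : Field K) (_ : NumberField K) (_ : IsCMField K), Nonempty (D j ≃ₐ[ℚ] K) := by
  obtain ⟨m, K, fK, nK, d, hd, ⟨e⟩⟩ := hX.exists_algEquiv_endAlgRat_pi_matrix_numberField h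
  haveI := hd
  obtain ⟨σ, hσ⟩ := exists_equiv_forall_eq_and_nonempty_algEquiv_of_algEquiv_pi_matrix e' e
  obtain ⟨φ⟩ := (hσ j).2
  exact ⟨K (σ j), fK _, nK _, hX.isCMField_of_algEquiv_endAlgRat_pi_matrix h e (σ j), ⟨φ⟩⟩

/-- **«`Dᵢ` is a commutative field»**: in any decomposition of `End_ℚ(X)` over division algebras (abelian variety with
`[End_ℚ(X) : ℚ]_red = 2 dim X`) the division algebras are commutative. [cite: MilneCM2006, Ch. I §3 Remark 3.5 (p. 28)] -/
theorem _root_.Literature.Geometry.Kaehler.ComplexTorus.IsAbelianVariety.divisionRing_mul_comm_of_algEquiv_endAlgRat_pi_matrix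
    (hX : IsAbelianVariety P) (h : reducedDegree ℚ ↥(endAlgRat P) = Fintype.card ι)
    (e' : ↥(endAlgRat P) ≃ₐ[ℚ] Π j, Matrix (Fin (d' j)) (Fin (d' j)) (D j)) (j : κ') (x y : D j) :
    x * y = y * x := by
  obtain ⟨K, _, _, _, ⟨φ⟩⟩ := hX.exists_isCMField_of_algEquiv_endAlgRat_pi_matrix_divisionRing h e' j
  apply φ.injective
  rw [map_mul, map_mul, mul_comm]

/-- **«… of degree `2 dim Aᵢ`», summed: `#ι = 2 dim X = Σⱼ d′ⱼ [Dⱼ : ℚ]`** along any decomposition of `End_ℚ(X)` over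
division algebras (abelian variety with `[End_ℚ(X) : ℚ]_red = 2 dim X`). [cite: MilneCM2006, Ch. I §3 Remark 3.5 (p. 28); §1 (1.2) (p. 9)] -/
theorem _root_.Literature.Geometry.Kaehler.ComplexTorus.IsAbelianVariety.card_eq_sum_of_algEquiv_endAlgRat_pi_matrix_divisionRing
    (hX : IsAbelianVariety P) (h : reducedDegree ℚ ↥(endAlgRat P) = Fintype.card ι)
    (e' : ↥(endAlgRat P) ≃ₐ[ℚ] Π j, Matrix (Fin (d' j)) (Fin (d' j)) (D j)) :
    Fintype.card ι = ∑ j, d' j * finrank ℚ (D j) := by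
  obtain ⟨m, K, fK, nK, d, hd, ⟨e⟩⟩ := hX.exists_algEquiv_endAlgRat_pi_matrix_numberField h
  haveI := hd
  obtain ⟨σ, hσ⟩ := exists_equiv_forall_eq_and_nonempty_algEquiv_of_algEquiv_pi_matrix e' e
  rw [card_eq_sum_of_algEquiv_endAlgRat_pi_matrix P h e, ← Equiv.sum_comp σ (fun i ↦ d i * finrank ℚ (K i))]
  refine Finset.sum_congr rfl fun j _ ↦ ?_
  obtain ⟨φ⟩ := (hσ j).2
  rw [(hσ j).1, φ.toLinearEquiv.finrank_eq]

end CMBlocks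

/-! ## §3 The package: CM fields and the reduced module `H₁(X, ℚ) ≅ ⊕ᵢ Kᵢ^{dᵢ}` -/

section Package

variable {P}

/-- ★★ **`End_ℚ(X) ≃ₐ[ℚ] ∏ᵢ M_{dᵢ}(Kᵢ)` OVER CM FIELDS `Kᵢ`, with `2 dim X = Σᵢ dᵢ[Kᵢ:ℚ]`**, for an abelian variety with
`[End_ℚ(X) : ℚ]_red = 2 dim X` (Prop. 3.1's second sentence with Remark 3.5 ∕ Prop. 3.6 (a): «`End⁰(A) ≃ ∏ᵢ M_{nᵢ}(Dᵢ)` … `Dᵢ`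
is a commutative field of degree `2 dim Aᵢ`», «CM-field»).
[cite: MilneCM2006, Ch. I §3 Prop. 3.1 (p. 27), Remark 3.5, Prop. 3.6 (a) (p. 28)] [cite: Deligne1982HodgeCycles, I §5 Prop. 5.1 (p. 53)] -/
theorem _root_.Literature.Geometry.Kaehler.ComplexTorus.IsAbelianVariety.exists_algEquiv_endAlgRat_pi_matrix_isCMField
    (hX : IsAbelianVariety P) (h : reducedDegree ℚ ↥(endAlgRat P) = Fintype.card ι) :
    ∃ (m : ℕ) (K : Fin m → Type) (_ : ∀ i, Field (K i)) (_ : ∀ i, NumberField (K i)) (_ : ∀ i, IsCMField (K i))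
      (d : Fin m → ℕ), (∀ i, NeZero (d i)) ∧
        Nonempty (↥(endAlgRat P) ≃ₐ[ℚ] Π i, Matrix (Fin (d i)) (Fin (d i)) (K i)) ∧
        Fintype.card ι = ∑ i, d i * finrank ℚ (K i) := by
  obtain ⟨m, K, fK, nK, d, hd, ⟨e⟩⟩ := hX.exists_algEquiv_endAlgRat_pi_matrix_numberField h
  haveI := hd
  exact ⟨m, K, fK, nK, fun i ↦ hX.isCMField_of_algEquiv_endAlgRat_pi_matrix h e i, d, hd, ⟨e⟩,
    card_eq_sum_of_algEquiv_endAlgRat_pi_matrix P h e⟩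

/-- ★★ **THE FULL PACKAGE (Prop. 3.6 (c) «in which case `H₁(A, ℚ)` is free of rank `1` over the algebra», with the CM
fields of (a)): `End_ℚ(X) ≃ₐ[ℚ] ∏ᵢ M_{dᵢ}(Kᵢ)` over CM FIELDS and `H₁(X, ℚ) = ℚ^ι ≃ₗ[ℚ] ⊕ᵢ Kᵢ^{dᵢ}` COMPATIBLY**
(`f (M *ᵥ v) = e M • f v`; the reduced module, A3-G146 FILE 4 `exists_linearEquiv_pi_vec_of_reducedDegree_endAlgRat_eq_card`),
for an abelian variety with `[End_ℚ(X) : ℚ]_red = 2 dim X`.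
[cite: MilneCM2006, Ch. I §3 Prop. 3.6 (a), (c) and proof of Prop. 3.3 («`H¹(A)` is reduced», p. 28); §1 p. 8] -/
theorem _root_.Literature.Geometry.Kaehler.ComplexTorus.IsAbelianVariety.exists_algEquiv_endAlgRat_pi_matrix_isCMField_linearEquiv
    (hX : IsAbelianVariety P) (h : reducedDegree ℚ ↥(endAlgRat P) = Fintype.card ι) :
    ∃ (m : ℕ) (K : Fin m → Type) (_ : ∀ i, Field (K i)) (_ : ∀ i, NumberField (K i)) (_ : ∀ i, IsCMField (K i))
      (d : Fin m → ℕ) (_ : ∀ i, NeZero (d i)) (e : ↥(endAlgRat P) ≃ₐ[ℚ] Π i, Matrix (Fin (d i)) (Fin (d i)) (K i))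
      (f : (ι → ℚ) ≃ₗ[ℚ] (Π i, Fin (d i) → K i)),
        ∀ (M : ↥(endAlgRat P)) (v : ι → ℚ), f ((M : Matrix ι ι ℚ).mulVec v) = e M • f v := by
  obtain ⟨m, K, fK, nK, cK, d, hd, ⟨e⟩, -⟩ := hX.exists_algEquiv_endAlgRat_pi_matrix_isCMField h
  haveI := hd
  obtain ⟨f, hf⟩ := exists_linearEquiv_pi_vec_of_reducedDegree_endAlgRat_eq_card P h e
  exact ⟨m, K, fK, nK, cK, d, hd, e, f, hf⟩

/-- ★ **REMARK 3.5's «IF AND ONLY IF», on the algebra: an abelian variety has complex multiplication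
(`[End_ℚ(X) : ℚ]_red = 2 dim X`) iff `End_ℚ(X) ≃ₐ[ℚ] ∏ᵢ M_{dᵢ}(Kᵢ)` with `Kᵢ` CM FIELDS and `Σᵢ dᵢ[Kᵢ:ℚ] = 2 dim X`**
(⟸ holds for any decomposition over fields, `reducedDegree_endAlgRat_eq_card_of_algEquiv_pi_matrix`).
[cite: MilneCM2006, Ch. I §3 Remark 3.5, Prop. 3.6 (a) (p. 28)] -/
theorem _root_.Literature.Geometry.Kaehler.ComplexTorus.IsAbelianVariety.reducedDegree_endAlgRat_eq_card_iff_exists_algEquiv_pi_matrix_isCMField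
    (hX : IsAbelianVariety P) :
    reducedDegree ℚ ↥(endAlgRat P) = Fintype.card ι ↔
      ∃ (m : ℕ) (K : Fin m → Type) (_ : ∀ i, Field (K i)) (_ : ∀ i, NumberField (K i)) (_ : ∀ i, IsCMField (K i))
        (d : Fin m → ℕ), (∀ i, NeZero (d i)) ∧
          Nonempty (↥(endAlgRat P) ≃ₐ[ℚ] Π i, Matrix (Fin (d i)) (Fin (d i)) (K i)) ∧
          Fintype.card ι = ∑ i, d i * finrank ℚ (K i) := by
  refine ⟨hX.exists_algEquiv_endAlgRat_pi_matrix_isCMField, ?_⟩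
  rintro ⟨m, K, fK, nK, -, d, hd, ⟨e⟩, hcard⟩
  haveI := hd
  exact reducedDegree_endAlgRat_eq_card_of_algEquiv_pi_matrix P e hcard

end Package

/-! ## §4 Simple tori: `End_ℚ(X)` is a CM field of degree `2 dim X` (Remark 3.5 «In particular», Prop. 3.6 (a)) -/

section Simple

variable {P}

/-- `End_ℚ(X)` of a simple torus of positive dimension is semisimple (a division algebra: Lange Cor. 2.4.26,
`IsSimple.isUnit_endAlgRat`; a division ring is a simple module over itself). [cite: Lange2023AbelianVarietiesComplex, §2.4.4 Cor. 2.4.26 (p. 124)] -/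
private theorem isSemisimpleRing_endAlgRat_of_isSimple₆₅ [Nonempty ι] (hS : IsSimple P) :
    IsSemisimpleRing ↥(endAlgRat P) := by
  haveI : IsSimpleModule ↥(endAlgRat P) ↥(endAlgRat P) :=
    isSimpleModule_self_iff_isUnit.2 ⟨inferInstance, fun a ha ↦ hS.isUnit_endAlgRat ha⟩
  infer_instance

/-- **REMARK 3.5 FOR A SIMPLE TORUS: `[End_ℚ(X) : ℚ]_red = 2 dim X` forces `End_ℚ(X)` to be COMMUTATIVE** («a simple abelian
variety `A` has complex multiplication if and only if `End⁰(A)` is a field of degree `2 dim A`»): `End_ℚ(X)` is a division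
algebra (`IsSimple.isUnit_endAlgRat`) and `≃ ∏ᵢ M_{dᵢ}(Kᵢ)` over fields (§1), so there is one block and it has size `1`.  No
polarisation is needed. [cite: MilneCM2006, Ch. I §3 Remark 3.5 (p. 28)] [cite: Lange2023AbelianVarietiesComplex, §2.4.4 Cor. 2.4.26 (p. 124)] -/
theorem _root_.Literature.Geometry.Kaehler.ComplexTorus.IsSimple.endAlgRat_mul_comm_of_reducedDegree_eq [Nonempty ι]
    (hS : IsSimple P) (h : reducedDegree ℚ ↥(endAlgRat P) = Fintype.card ι) (a b : ↥(endAlgRat P)) :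
    a * b = b * a := by
  classical
  haveI := isSemisimpleRing_endAlgRat_of_isSimple₆₅ hS
  obtain ⟨m, K, fK, nK, d, hd, ⟨e⟩⟩ := exists_algEquiv_endAlgRat_pi_matrix_numberField_of_reducedDegree_eq P h
  haveI := hd
  have hu : ∀ x : ↥(endAlgRat P), x ≠ 0 → IsUnit x := fun x hx ↦ hS.isUnit_endAlgRat hx
  have hd1 : ∀ i, d i = 1 := forall_eq_one_of_algEquiv_pi_matrix₆₅ hu e
  haveI : ∀ i, Subsingleton (Fin (d i)) := fun i ↦
    ⟨fun p q ↦ Fin.ext (by have hp := p.2.trans_eq (hd1 i); have hq := q.2.trans_eq (hd1 i); omega)⟩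
  apply e.injective
  rw [map_mul, map_mul]
  funext i
  ext p q
  rw [Pi.mul_apply, Pi.mul_apply, Matrix.mul_apply, Matrix.mul_apply, Fintype.sum_subsingleton _ p,
    Fintype.sum_subsingleton _ p, Subsingleton.elim q p, mul_comm]

/-- **… hence `End_ℚ(X)` IS A FIELD** (a commutative division algebra). [cite: MilneCM2006, Ch. I §3 Remark 3.5 (p. 28)]
[cite: Lange2023AbelianVarietiesComplex, §2.4.4 Cor. 2.4.26 (p. 124)] -/
theorem _root_.Literature.Geometry.Kaehler.ComplexTorus.IsSimple.isField_endAlgRat_of_reducedDegree_eq [Nonempty ι]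
    (hS : IsSimple P) (h : reducedDegree ℚ ↥(endAlgRat P) = Fintype.card ι) : IsField ↥(endAlgRat P) := by
  refine ⟨exists_pair_ne _, hS.endAlgRat_mul_comm_of_reducedDegree_eq h, fun {a} ha ↦ ?_⟩
  obtain ⟨u, hu⟩ := hS.isUnit_endAlgRat ha
  exact ⟨((u⁻¹ : (↥(endAlgRat P))ˣ) : ↥(endAlgRat P)), by rw [← hu, Units.mul_inv]⟩

/-- **… of degree `[End_ℚ(X) : ℚ] = #ι = 2 dim X`** (a commutative reduced algebra is its own maximal étale subalgebra:
`[End_ℚ X : ℚ] = [End_ℚ X : ℚ]_red = #ι`). [cite: MilneCM2006, Ch. I §3 Remark 3.5, Prop. 3.6 (a) (p. 28)] -/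
theorem _root_.Literature.Geometry.Kaehler.ComplexTorus.IsSimple.finrank_endAlgRat_eq_card_of_reducedDegree_eq [Nonempty ι]
    (hS : IsSimple P) (h : reducedDegree ℚ ↥(endAlgRat P) = Fintype.card ι) :
    finrank ℚ ↥(endAlgRat P) = Fintype.card ι := by
  have hF := hS.isField_endAlgRat_of_reducedDegree_eq h
  haveI : IsReduced ↥(endAlgRat P) := by
    letI := hF.toField
    infer_instance
  rw [← h, reducedDegree_eq_finrank_of_comm (hS.endAlgRat_mul_comm_of_reducedDegree_eq h)]

variable (P) in
/-- Conversely, **a complex torus whose `End_ℚ(X)` is a field of degree `2 dim X` has `[End_ℚ(X) : ℚ]_red = 2 dim X`**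
(the field itself is the étale subalgebra of (b)). [cite: MilneCM2006, Ch. I §3 Remark 3.5 and Prop. 3.3 (b) ⟹ (a) (p. 28)] -/
theorem reducedDegree_endAlgRat_eq_card_of_isField_of_finrank_eq (hF : IsField ↥(endAlgRat P))
    (hdim : finrank ℚ ↥(endAlgRat P) = Fintype.card ι) : reducedDegree ℚ ↥(endAlgRat P) = Fintype.card ι := by
  haveI : IsReduced ↥(endAlgRat P) := by
    letI := hF.toField
    infer_instance
  exact (reducedDegree_endAlgRat_eq_card_iff_exists_comm_isReduced P).2
    ⟨endAlgRat P, le_rfl, inferInstance, fun a ha b hb ↦ congrArg Subtype.val (hF.mul_comm ⟨a, ha⟩ ⟨b, hb⟩), hdim⟩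

/-- ★ **«A SIMPLE abelian variety `A` has complex multiplication if and only if `End⁰(A)` is a field of degree `2 dim A` over
`ℚ`»** — for every simple complex torus of positive dimension: `[End_ℚ(X) : ℚ]_red = #ι` iff `End_ℚ(X)` is a field with
`[End_ℚ(X) : ℚ] = #ι`. [cite: MilneCM2006, Ch. I §3 Remark 3.5 (p. 28)] -/
theorem _root_.Literature.Geometry.Kaehler.ComplexTorus.IsSimple.reducedDegree_endAlgRat_eq_card_iff_isField [Nonempty ι]
    (hS : IsSimple P) :
    reducedDegree ℚ ↥(endAlgRat P) = Fintype.card ι ↔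
      IsField ↥(endAlgRat P) ∧ finrank ℚ ↥(endAlgRat P) = Fintype.card ι :=
  ⟨fun h ↦ ⟨hS.isField_endAlgRat_of_reducedDegree_eq h, hS.finrank_endAlgRat_eq_card_of_reducedDegree_eq h⟩,
    fun h ↦ reducedDegree_endAlgRat_eq_card_of_isField_of_finrank_eq P h.1 h.2⟩

/-- ★★ **MILNE CM PROP. 3.6 (a), ⟹: a SIMPLE ABELIAN VARIETY with `[End_ℚ(X) : ℚ]_red = 2 dim X` has `End_ℚ(X) ≃ₐ[ℚ] K` for a
CM FIELD `K` with `[K : ℚ] = 2 dim X`** («if and only if `End⁰(A)` is a CM-field of degree `2 dim A` over `ℚ`»; Deligne's Prop.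
5.1 «Then `E` is a CM-field»).  The one-block decomposition `End_ℚ(X) ≃ M₁(K)` of §4 is a decomposition over number fields, to
which §2 applies. [cite: MilneCM2006, Ch. I §3 Prop. 3.6 (a) (p. 28)] [cite: Deligne1982HodgeCycles, I §5 Prop. 5.1 (p. 53)] -/
theorem _root_.Literature.Geometry.Kaehler.ComplexTorus.IsSimple.exists_isCMField_algEquiv_endAlgRat_of_reducedDegree_eq
    [Nonempty ι] (hS : IsSimple P) (hX : IsAbelianVariety P) (h : reducedDegree ℚ ↥(endAlgRat P) = Fintype.card ι) :
    ∃ (K : Type) (_ : Field K) (_ : NumberField K) (_ : IsCMField K),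
      Nonempty (↥(endAlgRat P) ≃ₐ[ℚ] K) ∧ finrank ℚ K = Fintype.card ι := by
  classical
  obtain ⟨m, K, fK, nK, d, hd, ⟨e⟩⟩ := hX.exists_algEquiv_endAlgRat_pi_matrix_numberField h
  haveI := hd
  have hu : ∀ x : ↥(endAlgRat P), x ≠ 0 → IsUnit x := fun x hx ↦ hS.isUnit_endAlgRat hx
  have hd1 : ∀ i, d i = 1 := forall_eq_one_of_algEquiv_pi_matrix₆₅ hu e
  haveI hsub : Subsingleton (Fin m) := subsingleton_of_algEquiv_pi_matrix₆₅ hu e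
  -- the product has exactly one factor `i₀`
  have hm : Nonempty (Fin m) := by
    by_contra h0
    haveI : IsEmpty (Fin m) := not_nonempty_iff.1 h0
    haveI : Subsingleton (Π i : Fin m, Matrix (Fin (d i)) (Fin (d i)) (K i)) := inferInstance
    haveI : Subsingleton ↥(endAlgRat P) := e.injective.subsingleton
    exact zero_ne_one (Subsingleton.elim (0 : ↥(endAlgRat P)) 1)
  obtain ⟨i₀⟩ := hm
  haveI : Unique (Fin m) := ⟨⟨i₀⟩, fun j ↦ Subsingleton.elim _ _⟩
  haveI : IsCMField (K i₀) := hX.isCMField_of_algEquiv_endAlgRat_pi_matrix h e i₀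
  -- `End_ℚ(X) ≃ ∏ M_{d i}(K i) ≃ M_{d i₀}(K i₀) ≃ M₁(K i₀) ≃ K i₀`
  have hπ : Function.Bijective (Pi.evalAlgHom ℚ (fun i : Fin m ↦ Matrix (Fin (d i)) (Fin (d i)) (K i)) i₀) := by
    refine ⟨fun f g hfg ↦ funext fun j ↦ ?_, fun y ↦ ⟨Function.update 0 i₀ y, ?_⟩⟩
    · obtain rfl : j = i₀ := Subsingleton.elim _ _
      exact hfg
    · rw [Pi.evalAlgHom_apply, Function.update_self]
  let π : (Π i : Fin m, Matrix (Fin (d i)) (Fin (d i)) (K i)) ≃ₐ[ℚ] Matrix (Fin (d i₀)) (Fin (d i₀)) (K i₀) :=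
    AlgEquiv.ofBijective _ hπ
  let e' : ↥(endAlgRat P) ≃ₐ[ℚ] K i₀ :=
    ((e.trans π).trans (Matrix.reindexAlgEquiv ℚ (K i₀) (finCongr (hd1 i₀)))).trans
      (Classical.choice (nonempty_matrix_fin_one_algEquiv₆₅ (K i₀)))
  refine ⟨K i₀, fK i₀, nK i₀, inferInstance, ⟨e'⟩, ?_⟩
  rw [← hS.finrank_endAlgRat_eq_card_of_reducedDegree_eq h]
  exact e'.toLinearEquiv.finrank_eq.symm

/-- ★★ **MILNE CM PROP. 3.6 (a) AS AN «IF AND ONLY IF», at torus level: a SIMPLE abelian variety `X` of positive dimension has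
complex multiplication (`[End_ℚ(X) : ℚ]_red = 2 dim X`) iff `End_ℚ(X)` is (isomorphic to) a CM FIELD of degree `2 dim X`.**
[cite: MilneCM2006, Ch. I §3 Prop. 3.6 (a) (p. 28)] [cite: Deligne1982HodgeCycles, I §5 Prop. 5.1 (p. 53)] -/
theorem _root_.Literature.Geometry.Kaehler.ComplexTorus.IsSimple.reducedDegree_endAlgRat_eq_card_iff_exists_isCMField
    [Nonempty ι] (hS : IsSimple P) (hX : IsAbelianVariety P) :
    reducedDegree ℚ ↥(endAlgRat P) = Fintype.card ι ↔
      ∃ (K : Type) (_ : Field K) (_ : NumberField K) (_ : IsCMField K),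
        Nonempty (↥(endAlgRat P) ≃ₐ[ℚ] K) ∧ finrank ℚ K = Fintype.card ι := by
  refine ⟨hS.exists_isCMField_algEquiv_endAlgRat_of_reducedDegree_eq hX, ?_⟩
  rintro ⟨K, fK, _nK, -, ⟨e'⟩, hK⟩
  refine reducedDegree_endAlgRat_eq_card_of_isField_of_finrank_eq P
    (MulEquiv.isField (Field.toIsField K) e'.toMulEquiv) ?_
  rw [e'.toLinearEquiv.finrank_eq, hK]

end Simple

end Literature.NumberTheory.ComplexMultiplication
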